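import Summits.CriticalPhenomena.PercolationContinuityZ3.Theorems.PercNearOneGluingAdditiveGluingTieReduction
import HarnessLib

/-!
# Crux `PercNearOneGluing.AdditiveGluing` (stmt-CriticalPhenomena-4576): the minimiser-tie reduction, pointwise form

Support file (`--supports stmt-CriticalPhenomena-4576`, lead prim-png-lead-4576).  No definitions, no named facts, no sorries.
`additiveGluing_pointwise_of_minTie`: for FIXED `(n, A, o, b)` the additive gluing inequality at all weight functions follows from its
instances with a tie at the minimum of `μ(·↔b)` on `A` (the induction of `stub_additiveGluingOfMinTie_k34`, file
`…AdditiveGluingTieReduction`, never changes `A, o, b`).  Used by the lead's skeleton to restrict the three-relay certificate (T1) to the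
tie locus `τ(a₁) = τ(a₃)`. [cite: KozmaNitzan2024, §5.3 (p. 34), Lemma 13]
-/

namespace Summit.CriticalPhenomena.PercolationContinuityZ3.Theorems

open MeasureTheory Set
open Literature.Probability.LatticeModels Literature.Probability.Percolation

noncomputable section
open Classical

variable {n : ℕ}

/-- **Pointwise minimiser-tie reduction** (fixed relay set, observer and target): if, for FIXED `n, A, o, b`, the additive
gluing inequality holds at every weight function under which two distinct relays of `A` tie at the minimum of `μ(·↔b)`, then it
holds at every weight function (for these `A, o, b`).  Same proof as `stub_additiveGluingOfMinTie_k34` (the induction on the number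
of fractional pairs never changes `A, o, b`); this form lets a skeleton restrict a three-relay certificate to the tie locus.
[cite: KozmaNitzan2024, §5.3 (p. 34), Lemma 13] -/
theorem additiveGluing_pointwise_of_minTie (n : ℕ) (A : Finset (Fin n)) (o b : Fin n)
    (hTie : ∀ (w : Sym2 (Fin n) → unitInterval),
      (∃ a ∈ A, ∃ a' ∈ A, a ≠ a' ∧ (prodBernoulli w).real (openConn a b) = (prodBernoulli w).real (openConn a' b) ∧
        ∀ c ∈ A, (prodBernoulli w).real (openConn a b) ≤ (prodBernoulli w).real (openConn c b)) →
      ∀ t : ℝ, 0 ≤ t → (∀ a ∈ A, 1 - t ≤ (prodBernoulli w).real (openConn a b)) →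
        (prodBernoulli w).real (⋃ a ∈ A, openConn o a) - t ≤ (prodBernoulli w).real (openConn o b)) :
    ∀ (w : Sym2 (Fin n) → unitInterval) (t : ℝ), 0 ≤ t →
      (∀ a ∈ A, 1 - t ≤ (prodBernoulli w).real (openConn a b)) →
      (prodBernoulli w).real (⋃ a ∈ A, openConn o a) - t ≤ (prodBernoulli w).real (openConn o b) := by
  -- strong induction on the number of fractional pairs
  suffices H : ∀ k : ℕ, ∀ w : Sym2 (Fin n) → unitInterval,
      (Finset.univ.filter (fun e : Sym2 (Fin n) => 0 < (w e : ℝ) ∧ (w e : ℝ) < 1)).card = k →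
      ∀ (t : ℝ), 0 ≤ t →
        (∀ a ∈ A, 1 - t ≤ (prodBernoulli w).real (openConn a b)) →
        (prodBernoulli w).real (⋃ a ∈ A, openConn o a) - t ≤ (prodBernoulli w).real (openConn o b) by
    intro w t ht hrel
    exact H _ w rfl t ht hrel
  intro k
  induction k using Nat.strong_induction_on with
  | _ k ih =>
  intro w hk t ht hrel
  have hIH : ∀ w' : Sym2 (Fin n) → unitInterval,
      (Finset.univ.filter (fun e : Sym2 (Fin n) => 0 < (w' e : ℝ) ∧ (w' e : ℝ) < 1)).card <
        (Finset.univ.filter (fun e : Sym2 (Fin n) => 0 < (w e : ℝ) ∧ (w e : ℝ) < 1)).card →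
      ∀ (t' : ℝ), 0 ≤ t' →
        (∀ a ∈ A, 1 - t' ≤ (prodBernoulli w').real (openConn a b)) →
        (prodBernoulli w').real (⋃ a ∈ A, openConn o a) - t' ≤ (prodBernoulli w').real (openConn o b) := by
    intro w' hlt t' ht' hrel'
    exact ih _ (hk ▸ hlt) w' rfl t' ht' hrel'
  -- trivial cases
  rcases A.eq_empty_or_nonempty with hAe | hAne
  · subst hAe
    simp only [Finset.notMem_empty, Set.iUnion_of_empty, Set.iUnion_empty, measureReal_empty]
    linarith [measureReal_nonneg (μ := prodBernoulli w) (s := openConn o b)]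
  -- the minimiser `a₀`
  obtain ⟨a₀, ha₀, hmin⟩ := Finset.exists_min_image A
    (fun a => (prodBernoulli w).real (openConn a b : Set (BondConfig (Fin n)))) hAne
  -- a tie at the minimum: the hypothesis
  by_cases htie : ∃ c ∈ A, c ≠ a₀ ∧ (prodBernoulli w).real (openConn c b) = (prodBernoulli w).real (openConn a₀ b)
  · obtain ⟨c, hc, hca, hceq⟩ := htie
    exact hTie w ⟨a₀, ha₀, c, hc, hca.symm, hceq.symm, hmin⟩ t ht hrel
  push Not at htie
  -- it suffices to prove the inequality with `t = 1 − μ(a₀ ↔ b)`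
  have hta₀ : 1 - t ≤ (prodBernoulli w).real (openConn a₀ b) := hrel a₀ ha₀
  suffices hmain : 0 ≤ (prodBernoulli w).real (openConn o b) - (prodBernoulli w).real (⋃ a ∈ A, openConn o a) +
      (1 - (prodBernoulli w).real (openConn a₀ b)) by linarith
  -- no fractional pair: deterministic base case
  by_cases hfr : ∃ e : Sym2 (Fin n), 0 < (w e : ℝ) ∧ (w e : ℝ) < 1
  swap
  · push Not at hfr
    have hw01 : ∀ e, w e = 0 ∨ w e = 1 := by
      intro e
      have h0 : 0 ≤ (w e : ℝ) := (w e).2.1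
      have h1 : (w e : ℝ) ≤ 1 := (w e).2.2
      rcases h0.lt_or_eq with hpos | hzero
      · right; exact Subtype.ext (le_antisymm h1 (hfr e hpos))
      · left; exact Subtype.ext hzero.symm
    have h1t : 0 ≤ 1 - (prodBernoulli w).real (openConn a₀ b : Set (BondConfig (Fin n))) := by
      linarith [measureReal_le_one (μ := prodBernoulli w) (s := openConn a₀ b)]
    have key := agBody_of_zeroOne w hw01 A o b (1 - (prodBernoulli w).real (openConn a₀ b)) h1t
      (fun a ha => by have := hmin a ha; linarith)
    linarith
  obtain ⟨e, he0, he1⟩ := hfr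
  -- the one-edge interpolation `w_s = w[e ↦ s]`
  set w0 : Sym2 (Fin n) → unitInterval := Function.update w e 0 with hw0
  set w1 : Sym2 (Fin n) → unitInterval := Function.update w e 1 with hw1
  let P0 : Set (BondConfig (Fin n)) → ℝ := fun S => (prodBernoulli w0).real S
  let P1 : Set (BondConfig (Fin n)) → ℝ := fun S => (prodBernoulli w1).real S
  let L : Set (BondConfig (Fin n)) → ℝ → ℝ := fun S s => P0 S + s * (P1 S - P0 S)
  have hL : ∀ (S : Set (BondConfig (Fin n))) (s : ℝ), s ∈ Set.Icc (0:ℝ) 1 →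
      (prodBernoulli (Function.update w e (Set.projIcc (0:ℝ) 1 zero_le_one s))).real S = L S s :=
    fun S s hs => real_update_affine w e S hs
  -- at `s = w e` the interpolation is `w` itself
  have hwe : Function.update w e (Set.projIcc (0:ℝ) 1 zero_le_one (w e : ℝ)) = w := by
    have : Set.projIcc (0:ℝ) 1 zero_le_one (w e : ℝ) = w e := by
      rw [Set.projIcc_of_mem _ ⟨(w e).2.1, (w e).2.2⟩]
    rw [this, Function.update_eq_self]
  have hwe_mem : ((w e : ℝ)) ∈ Set.Icc (0:ℝ) 1 := ⟨(w e).2.1, (w e).2.2⟩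
  -- the affine target and constraints
  let f : ℝ → ℝ := fun s => L (openConn o b) s - L (⋃ a ∈ A, openConn o a) s + (1 - L (openConn a₀ b) s)
  let g : Fin n → ℝ → ℝ := fun c s => L (openConn c b) s - L (openConn a₀ b) s
  have hf_aff : ∃ α β : ℝ, ∀ s, f s = α + β * s :=
    ⟨P0 (openConn o b) - P0 (⋃ a ∈ A, openConn o a) + (1 - P0 (openConn a₀ b)),
      (P1 (openConn o b) - P0 (openConn o b)) - (P1 (⋃ a ∈ A, openConn o a) - P0 (⋃ a ∈ A, openConn o a))
        - (P1 (openConn a₀ b) - P0 (openConn a₀ b)), fun s => by simp only [f, L]; ring⟩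
  have hg_aff : ∀ c ∈ A.erase a₀, ∃ α β : ℝ, ∀ s, g c s = α + β * s := fun c _ =>
    ⟨P0 (openConn c b) - P0 (openConn a₀ b),
      (P1 (openConn c b) - P0 (openConn c b)) - (P1 (openConn a₀ b) - P0 (openConn a₀ b)), fun s => by simp only [g, L]; ring⟩
  -- values of the interpolation at a parameter `s ∈ [0,1]`
  have hval : ∀ s : ℝ, ∀ hs : s ∈ Set.Icc (0:ℝ) 1, ∀ S : Set (BondConfig (Fin n)),
      L S s = (prodBernoulli (Function.update w e (Set.projIcc (0:ℝ) 1 zero_le_one s))).real S :=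
    fun s hs S => (hL S s hs).symm
  -- strict positivity of the constraints at `s₀ = w e` (no tie, `a₀` the minimiser)
  have hpos : ∀ c ∈ A.erase a₀, 0 < g c (w e : ℝ) := by
    intro c hc
    obtain ⟨hca, hcA⟩ := Finset.mem_erase.1 hc
    have h1 := hmin c hcA
    have h2 := htie c hcA hca
    have hlt : (prodBernoulli w).real (openConn a₀ b) < (prodBernoulli w).real (openConn c b) := lt_of_le_of_ne h1 (Ne.symm h2)
    simp only [g]
    rw [hval _ hwe_mem, hval _ hwe_mem, hwe]
    linarith
  -- the boundary hypothesis of `affine_nonneg_of_boundary`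
  have hbd : ∀ s : ℝ, 0 ≤ s → s ≤ 1 → (∀ c ∈ A.erase a₀, 0 ≤ g c s) →
      (s = 0 ∨ s = 1 ∨ ∃ c ∈ A.erase a₀, g c s = 0) → 0 ≤ f s := by
    intro s hs0 hs1 hG hdis
    have hs : s ∈ Set.Icc (0:ℝ) 1 := ⟨hs0, hs1⟩
    set ws : Sym2 (Fin n) → unitInterval := Function.update w e (Set.projIcc (0:ℝ) 1 zero_le_one s) with hws
    -- `a₀` is a minimiser at `w_s`
    have hmin_s : ∀ c ∈ A, (prodBernoulli ws).real (openConn a₀ b) ≤ (prodBernoulli ws).real (openConn c b) := by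
      intro c hcA
      by_cases hca : c = a₀
      · rw [hca]
      · have := hG c (Finset.mem_erase.2 ⟨hca, hcA⟩)
        simp only [g] at this
        rw [hval s hs, hval s hs] at this
        linarith
    have ht_s : 0 ≤ 1 - (prodBernoulli ws).real (openConn a₀ b : Set (BondConfig (Fin n))) := by
      linarith [measureReal_le_one (μ := prodBernoulli ws) (s := openConn a₀ b)]
    have hrel_s : ∀ a ∈ A, 1 - (1 - (prodBernoulli ws).real (openConn a₀ b)) ≤ (prodBernoulli ws).real (openConn a b) :=
      fun a ha => by have := hmin_s a ha; linarith
    -- the inequality at `w_s` with `t_s = 1 − μ_s(a₀ ↔ b)` gives `0 ≤ f s`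
    have hgoal : (prodBernoulli ws).real (⋃ a ∈ A, openConn o a) - (1 - (prodBernoulli ws).real (openConn a₀ b)) ≤
        (prodBernoulli ws).real (openConn o b) → 0 ≤ f s := by
      intro h
      simp only [f]
      rw [hval s hs, hval s hs, hval s hs]
      linarith
    apply hgoal
    rcases hdis with h0 | h1 | ⟨c, hc, hzero⟩
    · -- `s = 0`: fewer fractional pairs, induction
      have hws0 : ws = w0 := by
        rw [hws, hw0, h0]
        congr 1
        exact Subtype.ext (by simp [Set.projIcc])
      rw [hws0]
      refine hIH w0 ?_ _ (by rw [← hws0]; exact ht_s) (by rw [← hws0]; exact hrel_s)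
      exact tieRed_fracCard_update_lt w e 0 (Or.inl rfl) he0 he1
    · -- `s = 1`: fewer fractional pairs, induction
      have hws1 : ws = w1 := by
        rw [hws, hw1, h1]
        congr 1
        exact Subtype.ext (by simp [Set.projIcc])
      rw [hws1]
      refine hIH w1 ?_ _ (by rw [← hws1]; exact ht_s) (by rw [← hws1]; exact hrel_s)
      exact tieRed_fracCard_update_lt w e 1 (Or.inr rfl) he0 he1
    · -- a tie of `c ≠ a₀` with `a₀` at the minimum: the hypothesis
      obtain ⟨hca, hcA⟩ := Finset.mem_erase.1 hc
      have hceq : (prodBernoulli ws).real (openConn c b) = (prodBernoulli ws).real (openConn a₀ b) := by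
        simp only [g] at hzero
        rw [hval s hs, hval s hs] at hzero
        linarith
      exact hTie ws ⟨a₀, ha₀, c, hcA, Ne.symm hca, hceq.symm, hmin_s⟩ _ ht_s hrel_s
  -- conclude with the affine lemma at `s₀ = w e`
  have key := affine_nonneg_of_boundary (A.erase a₀) f g hf_aff hg_aff 0 1 (w e : ℝ) (w e).2.1 (w e).2.2 hpos hbd
  simp only [f] at key
  rw [hval _ hwe_mem, hval _ hwe_mem, hval _ hwe_mem, hwe] at key
  linarith

end

end Summit.CriticalPhenomena.PercolationContinuityZ3.Theorems
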